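import Summits.QuantumFields.YangMills.Theorems.LuscherReductionTwistedTraceScalingBOStiffTailShell
import Summits.QuantumFields.YangMills.Theorems.LuscherReductionTwistedTraceScalingBOStiffTailCurrency
import Summits.QuantumFields.YangMills.Theorems.LuscherReductionTwistedTraceScalingBODefectPieceRates
import Summits.QuantumFields.YangMills.Theorems.TwistedTraceScaling.Negative.OutPieceMagneticBound
import HarnessLib

/-!
# (B-ST) step (B), the shell tail INSTANCE for the record: on the gauge-near stiff shell of the record support the based average has transfer form `≤ a·Λ·‖f‖²_w`, any `a > 0`
# (lane A of S-BASE, crux `TwistedTraceScaling` stmt-QuantumFields-20203, C4-CORE, the (B-ST) pen; design card `pub/ym-fleet/ym-luscher-20007-p1/Lines-BST-poincare.md` (B); HANDOFF-g21 (S6''))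

The shell door `…BOStiffTailShell.qform_basedAvg_le_of_action_ge` wants an action floor `S ≥ s` on the support of the shell piece.  On the record support
(`…BORecordSupport.recordChi_support`: `U = orthoTube u x`, links within `43Mβ^{-s}` of `1`, slow mean within `517β^{-s}/|Site|`, `L³S₁ ≤ β^{-2s}`) the landed magnetic floor
R59 `…Negative.OutPieceMagneticBound.wilsonAction_orthoTube_ge_sq` gives `S(U) ≥ (gap/16)·‖relLinkVec U‖²` on the GAUGE-NEAR tube (`‖P_Γ relLinkVec U‖ ≤ ‖relLinkVec U‖/2`),
`gap = 2 − 2cos(2π/L)`.  This file: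
* §1 `basedAvg_recordChi`, `integral_sq_mul_basedAvg_div_recordChi` — for the record weight `P₀χ = gaugeAvg χ` (colour invariance), so the doors' weight `∫ f²·(P₀χ/χ)` IS `tubeNormSq (softWeight χ) f`;
* §2 ★★ `eventually_wilsonAction_ge_shell` — for ANY schedules `R₀, τ` with `2τ ≤ R₀` eventually: eventually in `β`, every `U` with `recordChi U ≠ 0`, `R₀ < ‖relLinkVec U‖`,
  `‖P_Γ relLinkVec U‖ ≤ τ` has `(gap/16)·R₀² ≤ S(U)` (all smallness from `recordChi_support`, every `s > 0`, `M ≥ 0`);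
* §3 ★★ `eventually_qform_basedAvg_shell_le` — hence `⟨P₀f, K_βP₀f⟩ ≤ (e^{2β})^{|E|}·e^{−β(gap/16)R₀²}·tubeNormSq (softWeight χ) f` for every bounded measurable `f` living on that shell;
* §4 ★★★ `eventually_qform_basedAvg_shell_record` — the schedule of record `R₀ = r_f/2`, `r_f = min(1/40, β^{-1/2}ℓ)`, `τ = β^{-1}ℓ` (`ℓ = btLog β`): `β(gap/16)R₀² = (gap/64)ℓ²`
  (`…BODefectPieceRates.eventually_beta_mul_rf_sq`), so by the tail budget `…BOStiffTailCurrency.eventually_tail_budget_le`, for EVERY `a > 0`, eventually in `β`,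
  `⟨P₀f, K_βP₀f⟩ ≤ a·Λ(β)·tubeNormSq (softWeight (recordChi L s 43 M β)) f` for all bounded measurable `f` supported in `{recordChi ≠ 0} ∩ {r_f/2 < ‖relLinkVec‖} ∩ {‖P_Γ relLinkVec‖ ≤ β^{-1}ℓ}`,
  `Λ` the literal currency of `…BORecordInputOfST.recordAnalyticInput_of_hST`.  With `…BOStiffColour.tubeForm_le_qform_basedIntegral` this is the shell third of the split of `hST`.
HONEST FRAMING: bookkeeping for a stub of a child of the CONDITIONAL route R2b1; (B-ST) OPEN; C4-CORE OPEN; not infinite volume, not a gap, not Clay.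
-/

set_option autoImplicit false

noncomputable section

open MeasureTheory Filter Topology Real
open scoped BigOperators
open Literature.MathematicalPhysics.QuantumFieldTheory
open Literature.MathematicalPhysics.QuantumLattice

namespace Summit.QuantumFields.YangMills.Theorems.FemtoTransferGap.TwoLattice.ConstTube

open Summit.QuantumFields.YangMills.Theorems.FemtoTransferGap
open Summit.QuantumFields.YangMills.Theorems.FemtoTransferGap.TwoLattice
open Summit.QuantumFields.YangMills.Theorems.FemtoTransferGap.TwoLattice.Avg
open Summit.QuantumFields.YangMills.Theorems.FemtoTransferGap.TwoLattice.Stiff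
open Summit.QuantumFields.YangMills.Theorems.FemtoTransferGap.TwoLattice.GnChart
open Summit.QuantumFields.YangMills.Theorems.FemtoTransferGap.TwoLattice.Cov
open Summit.QuantumFields.YangMills.Theorems.FemtoTransferGap.TwoLattice.Toron
open Summit.QuantumFields.YangMills.Theorems.TwistedTraceScaling.Negative

variable {L : ℕ} [NeZero L]

/-! ## §1 The weight of the doors is the soft weight of record -/

/-- For the record weight the based average is the full gauge average, `P₀χ = gaugeAvg χ` (colour invariance of `χ`). [folklore] -/
theorem basedAvg_recordChi (s K M β : ℝ) (U : GaugeConfig 3 L SU2) :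
    (∫ h, recordChi L s K M β (gaugeTransform (basedExt L h) U) ∂basedMeasure L) = gaugeAvg (recordChi L s K M β) U := by
  obtain ⟨hm, h1, -, -⟩ := recordChi_props (L := L) s K M β
  exact basedAvg_eq_gaugeAvg_of_colourInvariant hm h1 (fun c V => by unfold recordChi; exact recordWeightRho_conj L c _ _ _ β V) U

/-- `∫ f²·(P₀χ/χ) = tubeNormSq (softWeight χ) f` for the record weight. [folklore] -/
theorem integral_sq_mul_basedAvg_div_recordChi (s K M β : ℝ) (f : GaugeConfig 3 L SU2 → ℝ) :
    ∫ U, f U ^ 2 * ((∫ h, recordChi L s K M β (gaugeTransform (basedExt L h) U) ∂basedMeasure L) / recordChi L s K M β U) ∂configMeasure SU2 L =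
      tubeNormSq (softWeight (recordChi L s K M β)) f := by
  unfold tubeNormSq softWeight
  refine integral_congr_ae (ae_of_all _ fun U => ?_)
  simp only [basedAvg_recordChi]

/-! ## §2 ★★ The action floor on the gauge-near shell of the record support, eventually in `β` -/

/-- ★★ **ACTION FLOOR ON THE SHELL OF RECORD**: for `L ≥ 2`, `s > 0`, `M ≥ 0` and any schedules `R₀, τ` with `2τ ≤ R₀` eventually, eventually in `β` every `U` with
`recordChi L s 43 M β U ≠ 0`, `R₀ < ‖relLinkVec U‖` and `‖P_Γ(relLinkVec U)‖ ≤ τ` satisfies `(gap/16)·R₀² ≤ S(U)`, `gap = 2 − 2cos(2π/L)`. [cite: Luscher1983, §3] -/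
theorem eventually_wilsonAction_ge_shell (hL : 2 ≤ L) {s : ℝ} (hs : 0 < s) {M : ℝ} (hM : 0 ≤ M) (R₀ τ : ℝ → ℝ)
    (h2τ : ∀ᶠ β : ℝ in atTop, 2 * τ β ≤ R₀ β) :
    ∀ᶠ β : ℝ in atTop, ∀ U : GaugeConfig 3 L SU2, recordChi L s 43 M β U ≠ 0 → R₀ β < ‖relLinkVec L U‖ →
      ‖(gaugeModes L).starProjection (relLinkVec L U)‖ ≤ τ β →
        (2 - 2 * Real.cos (2 * Real.pi / L)) / 16 * R₀ β ^ 2 ≤ wilsonAction su2Rep U := by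
  set gap : ℝ := 2 - 2 * Real.cos (2 * Real.pi / L) with hgapdef
  have hgap : 0 < gap := gap_pos L hL
  set NS : ℝ := (Fintype.card (Site 3 L) : ℝ) with hNSdef
  set n : ℝ := (Fintype.card (Edge 3 L × Fin 3) : ℝ) with hndef
  set NP : ℝ := (Fintype.card (Plaquette 3 L × Fin 3) : ℝ) with hNPdef
  set P : ℝ := (Fintype.card (Plaquette 3 L) : ℝ) with hPdef
  -- the a-priori schedules of the record support
  set τu : ℝ → ℝ := fun β => 517 / NS * powScale s β with hτudef
  set ρ : ℝ → ℝ := fun β => Real.sqrt n * ((M * 43 + 517 / NS) * powScale s β) with hρdef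
  have hps : Tendsto (powScale s) atTop (𝓝 0) := tendsto_powScale hs
  have Tτu : Tendsto τu atTop (𝓝 0) := by simpa [hτudef] using hps.const_mul (517 / NS)
  have T2 : Tendsto (fun β => 504 * τu β * Real.sqrt NP) atTop (𝓝 0) := by simpa using (Tτu.const_mul 504).mul_const (Real.sqrt NP)
  have Tρ : Tendsto ρ atTop (𝓝 0) := by simpa [hρdef] using (hps.const_mul (M * 43 + 517 / NS)).const_mul (Real.sqrt n)
  have T5 : Tendsto (fun β => P * (1728 * powScale s β + 29376 * ρ β + 700569 * ρ β ^ 2)) atTop (𝓝 0) := by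
    have h := (((hps.const_mul 1728).add (Tρ.const_mul 29376)).add ((Tρ.pow 2).const_mul 700569)).const_mul P
    have e : P * (1728 * 0 + 29376 * 0 + 700569 * 0 ^ 2) = 0 := by ring
    rw [e] at h
    exact h
  have hc2 : (0 : ℝ) < Real.sqrt gap / 8 := by positivity
  have hc5 : (0 : ℝ) < gap / 128 := by positivity
  filter_upwards [recordChi_support (L := L) hs hM, Tτu.eventually (gt_mem_nhds one_pos), T2.eventually (gt_mem_nhds hc2),
    Tρ.eventually (gt_mem_nhds (show (0 : ℝ) < 1 / 30 by norm_num)), T5.eventually (gt_mem_nhds hc5), h2τ] with β hsupp h1 h2 h4 h5 h6 U hUχ hUR hUΓ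
  have herr : P * (1728 * Real.sqrt (powScale (2 * s) β) + 29376 * ρ β + 700569 * ρ β ^ 2) ≤ gap / 128 := by rw [R59.sqrt_powScale_two_mul]; exact h5.le
  obtain ⟨hlink, -, hUT, hslow, hact⟩ := hsupp U hUχ
  obtain ⟨u, x, hx, rfl⟩ := hUT
  rw [slowMean_orthoTube L u hx] at hslow hact
  rw [relLinkVec_orthoTube L u hx] at hUR hUΓ
  have hu : ∀ (k : Fin 3) (c : Fin 3), |vecPart (u (0, k)) c| ≤ τu β := fun k c => (abs_vecPart_le_norm_sub_one _ c).trans (hslow k)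
  have hent : ∀ (e : Edge 3 L) (c : Fin 3), |x e c| ≤ (M * 43 + 517 / NS) * powScale s β := fun e c => by
    have h := R59.abs_entry_le_of_links hx hlink hslow e c
    linarith
  have hps0 : 0 < powScale s β := powScale_pos s β
  have hρU : ‖linkEmbed L x‖ ≤ ρ β := R59.norm_linkEmbed_le_of_entry_le (by positivity) hent
  have hR0 : 0 ≤ R₀ β := by linarith [norm_nonneg ((gaugeModes L).starProjection (linkEmbed L x))]
  have hΓ : ‖(gaugeModes L).starProjection (linkEmbed L x)‖ ≤ ‖linkEmbed L x‖ / 2 := by linarith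
  have hfloor := R59.wilsonAction_orthoTube_ge_sq hL u hx h1.le hu h2.le (powScale_le_one (by positivity) β) hact hρU h4.le herr hΓ
  have hsq : R₀ β ^ 2 ≤ ‖linkEmbed L x‖ ^ 2 := pow_le_pow_left₀ hR0 hUR.le 2
  have hg : 0 ≤ gap / 16 := by positivity
  exact (mul_le_mul_of_nonneg_left hsq hg).trans hfloor

/-! ## §3 ★★ The shell bound for arbitrary schedules -/

/-- ★★ **THE SHELL TAIL, eventually in `β`, for schedules `R₀, τ` with `2τ ≤ R₀` eventually**: for every bounded measurable `f` supported in
`{recordChi ≠ 0} ∩ {R₀ < ‖relLinkVec‖} ∩ {‖P_Γ relLinkVec‖ ≤ τ}`, `⟨P₀f, K_βP₀f⟩ ≤ (e^{2β})^{|E|}·e^{−β·(gap/16)·R₀²}·tubeNormSq (softWeight χ) f`. [cite: Luscher1983, §3] [cite: SeilerLNP1982, §3] -/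
theorem eventually_qform_basedAvg_shell_le (hL : 2 ≤ L) {s : ℝ} (hs : 0 < s) {M : ℝ} (hM : 0 ≤ M) (R₀ τ : ℝ → ℝ)
    (h2τ : ∀ᶠ β : ℝ in atTop, 2 * τ β ≤ R₀ β) :
    ∀ᶠ β : ℝ in atTop, ∀ f : GaugeConfig 3 L SU2 → ℝ, Measurable f → ∀ Cf : ℝ, (∀ U, |f U| ≤ Cf) →
      (∀ U, f U ≠ 0 → recordChi L s 43 M β U ≠ 0 ∧ R₀ β < ‖relLinkVec L U‖ ∧ ‖(gaugeModes L).starProjection (relLinkVec L U)‖ ≤ τ β) →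
      qform su2Rep β (fun U => ∫ h, f (gaugeTransform (basedExt L h) U) ∂basedMeasure L) (fun U => ∫ h, f (gaugeTransform (basedExt L h) U) ∂basedMeasure L) ≤
        Real.exp (2 * β) ^ Fintype.card (Edge 3 L) * Real.exp (-(β * ((2 - 2 * Real.cos (2 * Real.pi / L)) / 16 * R₀ β ^ 2))) *
          tubeNormSq (softWeight (recordChi L s 43 M β)) f := by
  filter_upwards [eventually_ge_atTop (0 : ℝ), eventually_wilsonAction_ge_shell hL hs hM R₀ τ h2τ] with β hβ hS f hf Cf hCf hsupp
  obtain ⟨hχm, hχ1, hχ0, hχc⟩ := recordChi_props (L := L) s 43 M β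
  have h := qform_basedAvg_le_of_action_ge hβ hf hCf hχm hχ1 hχ0 (Real.exp_pos _) (fun U hU => (hχc U hU).1)
    (fun U hU => by by_contra hne; exact (hsupp U hne).1 hU) (s := (2 - 2 * Real.cos (2 * Real.pi / L)) / 16 * R₀ β ^ 2)
    (fun U hU => by obtain ⟨hU1, hU2, hU3⟩ := hsupp U hU; exact hS U hU1 hU2 hU3)
  rw [integral_sq_mul_basedAvg_div_recordChi] at h
  exact h

/-! ## §4 ★★★ The schedule of record and its currency -/

/-- The schedule of record: `2·β^{-1}ℓ ≤ r_f/2` eventually (`r_f = min(1/40, β^{-1/2}ℓ)`, `ℓ = btLog β`). [folklore] -/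
theorem eventually_two_tau_le_half_rf :
    ∀ᶠ β : ℝ in atTop, 2 * (powScale 1 β * btLog β) ≤ min (1 / 40) (powScale (1 / 2) β * btLog β) / 2 := by
  have h1 : Tendsto (fun β : ℝ => powScale 1 β * btLog β) atTop (𝓝 0) := by
    simpa only [pow_one] using tendsto_powScale_mul_btLog_pow (p := 1) one_pos 1
  have h2 : Tendsto (powScale (1 / 2)) atTop (𝓝 0) := tendsto_powScale (by norm_num)
  filter_upwards [h1.eventually (eventually_le_nhds (show (0 : ℝ) < 1 / 160 by norm_num)), h2.eventually (eventually_le_nhds (show (0 : ℝ) < 1 / 4 by norm_num))]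
    with β hβ1 hβ2
  have hℓ : 0 ≤ btLog β := (zero_le_one.trans (one_le_btLog β))
  have hp : 0 ≤ powScale (1 / 2) β := (powScale_pos _ _).le
  have e : powScale 1 β * btLog β = powScale (1 / 2) β * (powScale (1 / 2) β * btLog β) := by rw [← mul_assoc, ← sq, powScale_half_sq']
  rw [le_div_iff₀ (by norm_num : (0 : ℝ) < 2), le_min_iff]
  constructor
  · linarith
  · rw [e]
    have : powScale (1 / 2) β * (powScale (1 / 2) β * btLog β) ≤ 1 / 4 * (powScale (1 / 2) β * btLog β) :=
      mul_le_mul_of_nonneg_right hβ2 (mul_nonneg hp hℓ)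
    linarith

omit [NeZero L] in
/-- The exponent of record: `β·(gap/16)·(r_f/2)² = (gap/64)·ℓ²` eventually. [folklore] -/
theorem eventually_shell_exponent_eq :
    ∀ᶠ β : ℝ in atTop, β * ((2 - 2 * Real.cos (2 * Real.pi / L)) / 16 * (min (1 / 40) (powScale (1 / 2) β * btLog β) / 2) ^ 2) =
      (2 - 2 * Real.cos (2 * Real.pi / L)) / 64 * btLog β ^ 2 := by
  filter_upwards [eventually_beta_mul_rf_sq] with β hβ
  rw [div_pow, ← hβ]; ring

set_option maxHeartbeats 800000 in
-- long record expressions.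
/-- ★★★ **THE SHELL TAIL OF RECORD IN THE CURRENCY OF `hST`**: for `L ≥ 2`, `s > 0`, `M ≥ 0` and EVERY `a > 0`, eventually in `β`, every bounded measurable `f` supported in
`{recordChi L s 43 M β ≠ 0} ∩ {r_f/2 < ‖relLinkVec‖} ∩ {‖P_Γ relLinkVec‖ ≤ β^{-1}ℓ}` has `⟨P₀f, K_βP₀f⟩ ≤ a·Λ(β)·tubeNormSq (softWeight (recordChi L s 43 M β)) f`,
`Λ(β) = (btC/fpZ(btEps)/γ)·λ₀(L³β)` the literal currency of `recordAnalyticInput_of_hST`. [cite: Luscher1983, §3] [cite: SeilerLNP1982, §3] -/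
theorem eventually_qform_basedAvg_shell_record (hL : 2 ≤ L) {s : ℝ} (hs : 0 < s) {M : ℝ} (hM : 0 ≤ M) {a : ℝ} (ha : 0 < a) :
    ∀ᶠ β : ℝ in atTop, ∀ f : GaugeConfig 3 L SU2 → ℝ, Measurable f → ∀ Cf : ℝ, (∀ U, |f U| ≤ Cf) →
      (∀ U, f U ≠ 0 → recordChi L s 43 M β U ≠ 0 ∧ min (1 / 40) (powScale (1 / 2) β * btLog β) / 2 < ‖relLinkVec L U‖ ∧
        ‖(gaugeModes L).starProjection (relLinkVec L U)‖ ≤ powScale 1 β * btLog β) →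
      qform su2Rep β (fun U => ∫ h, f (gaugeTransform (basedExt L h) U) ∂basedMeasure L) (fun U => ∫ h, f (gaugeTransform (basedExt L h) U) ∂basedMeasure L) ≤
        a * (btC L β (fun x : LinkSpace L => {x : LinkSpace L | linkCurry x ∈ capBalancedSet L}.indicator (fun _ => (1 : ℝ)) x * frozenProfile L (fun β' => stiffGaussExp L (β' / 2) β') (fun β' => min (1 / 40) (powScale (1 / 2) β' * btLog β')) β x) (btEps β) (5 * (powScale (1 / 2) β * btLog β ^ 2)) / fpZ (btEps β) / recordGamma L (fun β' => fun x : LinkSpace L => {x : LinkSpace L | linkCurry x ∈ capBalancedSet L}.indicator (fun _ => (1 : ℝ)) x * frozenProfile L (fun β'' => stiffGaussExp L (β'' / 2) β'') (fun β'' => min (1 / 40) (powScale (1 / 2) β'' * btLog β'')) β' x) β *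
          levelValue su2Rep 1 ((L : ℝ) ^ 3 * β) 0) * tubeNormSq (softWeight (recordChi L s 43 M β)) f := by
  have hgap : 0 < 2 - 2 * Real.cos (2 * Real.pi / L) := gap_pos L hL
  have hq : 0 < (2 - 2 * Real.cos (2 * Real.pi / L)) / 64 := by positivity
  filter_upwards [eventually_qform_basedAvg_shell_le hL hs hM (fun β => min (1 / 40) (powScale (1 / 2) β * btLog β) / 2) (fun β => powScale 1 β * btLog β)
    eventually_two_tau_le_half_rf, eventually_shell_exponent_eq (L := L), eventually_tail_budget_le (L := L) hq zero_le_one ha] with β hsh hexp hbud f hf Cf hCf hsupp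
  have h1 := hsh f hf Cf hCf hsupp
  rw [hexp] at h1
  have hT0 : 0 ≤ tubeNormSq (softWeight (recordChi L s 43 M β)) f :=
    integral_nonneg fun U => mul_nonneg (sq_nonneg _) ((softWeight_recordChi_props (L := L) s 43 M β).2.2.1 U)
  rw [one_mul] at hbud
  exact h1.trans (mul_le_mul_of_nonneg_right hbud hT0)

end Summit.QuantumFields.YangMills.Theorems.FemtoTransferGap.TwoLattice.ConstTube

end
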